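import Summits.ValiantsHypothesis.ValiantsHypothesis.Theorems.LacunarySymmetroidMatrixDescartesCensusTropicalKLaw

/-!
# Route «KPlusLogSqLaw», crux `TropicalB` (stmt-ValiantsHypothesis-19771) — POLYNOMIAL TOWERS AND THE RADIX OF
# POLYNOMIAL-NODE ODOMETERS: what the fat stub says, and what a refutation must build, on formats `m ≤ K^c`

HONEST FRAMING.  Helper toward the registered stubs `stub_tropFat` / `stub_tropThin` / `stub_tropTowerLog` of
`Cruxes/TropicalB/Lines/birth.lean` (crux `Summit.ValiantsHypothesis.ValiantsHypothesis.Theses.KPlusLogSqLaw.TropicalB`, item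
stmt-ValiantsHypothesis-19771, route KPlusLogSqLaw; cell `pub-symmetroid`, seat val-sym-trop-p3 g9, 2026-08-27; `--supports … --as helper`).
ARITHMETIC BOOKKEEPING between statements that are OPEN; nothing here bounds the crux inside its window, and nothing bears on `WeakLifting`,
DoorA26 / DoorA34, `MatrixDescartes` (stmt-ValiantsHypothesis-18050) or VP ≠ VNP.  Everything is stated in the Theorems-side currency
`TropicalCensus.TropRootLawAt` / `TropicalCensus.TropKPlusLogSqLaw`, which are the route's `TropRow` / `TropicalB` by `Iff.rfl`
(`tropRow_iff_tropRootLawAt`, `tropicalB_iff` of the birth file), so every statement transfers verbatim.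

THE POINT.  The fat stub `∃ C, ∀ m K, log₂² m ≤ K → T(m,K) ≤ 2^{C·K}` has all of its content at formats of POLYNOMIAL size in `K`
and beyond (up to `m = 2^{√K}`); slope counting gives `K·log₂(em/K)` bits there.  This file pins the polynomial part in closed form:

* `sq_log_succ_le_self` — the crossover arithmetic: `c²·(⌊log₂ K⌋ + 1)² ≤ K` as soon as `4^(max c 8) ≤ K`.
* `polyTower_uniform` — **`TropKPlusLogSqLaw` ⇒ ONE constant for ALL polynomial towers**: with `C` the constant of the law,
  every format `m ≤ K^c` with `4^(max c 8) ≤ K` has `TropRootLawAt m K (2^(2C·K))` — «O(1) bits per slope class, uniformly in the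
  polynomial degree `c`» (the `log₂² m ≤ c²(log₂ K + 1)²` term is absorbed by `K` past the crossover).  The registered foothold
  `stub_tropTowerLog` (`m = K·⌊log₂ K⌋`) and trop-p5's square tower (`m = K²`, `squareTower_of_tropicalB`) are the heights `c = 2`;
  `polyTower` is the all-`K` form at a fixed degree `c` (constant `C·(4c²(2·max c 8 + 1)² + 2)`, small `K` absorbed).
* `radixCap_of_tropKPlusLogSqLaw` — the same read as a RADIX CAP: under the law there is ONE `R` (`= 4^C`) such that no design on
  `m ≤ K^c` nodes, `K` past the crossover, carries a sign-alternating dominant chain longer than `R^K` — a `K`-digit odometer realised by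
  dominant terms on polynomially many nodes has bounded radix.
* `not_tropKPlusLogSqLaw_of_polyOdometers` — **the construction target, poly-node form**: if for EVERY radix `r` there are `c, K₀` such
  that every `K ≥ K₀` admits a design of some format `(m, K)`, `m ≤ K^c`, with a sign-alternating dominant chain of more than `r^K` terms
  («`K`-digit radix-`r` odometers on `poly_r(K)` nodes, for unboundedly large `r`»), then `TropKPlusLogSqLaw` (≡ `TropicalB`) fails.
  This sharpens the tree's refutation bridges in the node budget: `TropicalMonster` (…MatrixDescartesFalseOfTropicalMonster /
  `not_tropicalMonster_of_tropKPlusLogSqLaw`) asks for `B^q > 2^{K⌊log₂ K⌋}` (super-exponential chains) on `m ≤ 2^{polylog K}` nodes, and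
  `not_tropicalB_of_countingTightThin` for counting-tightness on the whole thin regime; here exponential chains `r^K` with every FIXED base
  `r`, on polynomially many nodes, suffice — and conversely (by `radixCap_of_tropKPlusLogSqLaw`) nothing less can refute the law on
  polynomial towers.  Located, not claimed: the cell's families give `T ≥ (K−3)m² + 2m` (ShiftDiamond) and `T(4^L n², L+2) ≥ n^L − 1`
  (staircase), i.e. NOT EVEN radix `2` on polynomially many nodes is known; the hypothesis is a target, not a fact.

[arithmetic; the statements are the cell's bookkeeping — no citation exists]
-/

set_option linter.dupNamespace false
set_option autoImplicit false

namespace Summit.ValiantsHypothesis.ValiantsHypothesis.Theorems.KPlusLogSqLaw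

namespace PolyTowers

open Summit.ValiantsHypothesis.ValiantsHypothesis.Theorems.LacunarySymmetroidMatrixDescartes.TropicalCensus

/-! ## 1. Crossover arithmetic: `c²(⌊log₂ K⌋+1)² ≤ K` for `K ≥ 4^(max c 8)` -/

/-- `s·(2s+2) ≤ 2^s` for `s ≥ 8`. [arithmetic] -/
theorem mul_le_two_pow_of_eight_le (s : ℕ) (hs : 8 ≤ s) : s * (2 * s + 2) ≤ 2 ^ s := by
  induction s, hs using Nat.le_induction with
  | base => norm_num
  | succ s hs ih =>
    have h2 : (s + 1) * (2 * (s + 1) + 2) ≤ 2 * (s * (2 * s + 2)) := by nlinarith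
    calc (s + 1) * (2 * (s + 1) + 2) ≤ 2 * (s * (2 * s + 2)) := h2
      _ ≤ 2 * 2 ^ s := Nat.mul_le_mul_left 2 ih
      _ = 2 ^ (s + 1) := by rw [pow_succ]; ring

/-- `⌊log₂ m⌋ ≤ c·(⌊log₂ K⌋ + 1)` whenever `m ≤ K^c`. [arithmetic] -/
theorem log_le_of_le_pow {m K c : ℕ} (hm : m ≤ K ^ c) : Nat.log 2 m ≤ c * (Nat.log 2 K + 1) := by
  rcases Nat.eq_zero_or_pos c with rfl | hc
  · simp only [pow_zero] at hm
    have : Nat.log 2 m = 0 := Nat.log_eq_zero_iff.2 (Or.inl (by omega))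
    simp [this]
  rcases Nat.eq_zero_or_pos m with rfl | hmpos
  · simp
  have hK : K < 2 ^ (Nat.log 2 K + 1) := Nat.lt_pow_succ_log_self (by norm_num) K
  have hKc : K ^ c < 2 ^ (c * (Nat.log 2 K + 1)) := by
    have e : 2 ^ (c * (Nat.log 2 K + 1)) = (2 ^ (Nat.log 2 K + 1)) ^ c := by
      rw [mul_comm, pow_mul]
    rw [e]
    exact Nat.pow_lt_pow_left hK hc.ne'
  have hlt : m < 2 ^ (c * (Nat.log 2 K + 1)) := lt_of_le_of_lt hm hKc
  exact Nat.le_of_lt_succ (Nat.lt_succ_of_lt (Nat.log_lt_of_lt_pow hmpos.ne' hlt))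

/-- **Crossover.**  For `K ≥ 4^(max c 8)`: `c²·(⌊log₂ K⌋ + 1)² ≤ K`. [arithmetic] -/
theorem sq_log_succ_le_self (c K : ℕ) (hK : 4 ^ (max c 8) ≤ K) : c ^ 2 * (Nat.log 2 K + 1) ^ 2 ≤ K := by
  set M := max c 8 with hM
  have hM8 : 8 ≤ M := le_max_right _ _
  have hcM : c ≤ M := le_max_left _ _
  have hKpos : K ≠ 0 := by
    have : 0 < 4 ^ M := pow_pos (by norm_num) M
    omega
  -- `2M ≤ L := ⌊log₂ K⌋`
  set L := Nat.log 2 K with hL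
  have h4 : 4 ^ M = 2 ^ (2 * M) := by rw [pow_mul]; norm_num
  have h2M : 2 * M ≤ L := by
    rw [hL]
    exact Nat.le_log_of_pow_le (by norm_num) (h4 ▸ hK)
  -- `s := L / 2 ≥ M`
  set s := L / 2 with hs
  have hsM : M ≤ s := by omega
  have hs8 : 8 ≤ s := le_trans hM8 hsM
  have hLs : L + 1 ≤ 2 * s + 2 := by omega
  have h1 : c * (L + 1) ≤ s * (2 * s + 2) := Nat.mul_le_mul (le_trans hcM hsM) hLs
  have h2 : c * (L + 1) ≤ 2 ^ s := le_trans h1 (mul_le_two_pow_of_eight_le s hs8)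
  have h3 : c ^ 2 * (L + 1) ^ 2 ≤ 2 ^ (2 * s) := by
    have : c ^ 2 * (L + 1) ^ 2 = (c * (L + 1)) ^ 2 := by ring
    rw [this, pow_mul', sq, sq]
    exact Nat.mul_le_mul h2 h2
  have h5 : 2 ^ (2 * s) ≤ 2 ^ L := Nat.pow_le_pow_right (by norm_num) (by omega)
  have h6 : 2 ^ L ≤ K := by rw [hL]; exact Nat.pow_log_le_self 2 hKpos
  exact le_trans h3 (le_trans h5 h6)

/-! ## 2. One constant for all polynomial towers -/

/-- **`TropKPlusLogSqLaw` ⇒ UNIFORM `O(1)` bits per class on every polynomial tower.**  If the tropical `K + log² m` law holds with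
constant `C`, then every format `m ≤ K^c` past the crossover `K ≥ 4^(max c 8)` satisfies `TropRootLawAt m K (2^(2C·K))` — the constant
`2C` does not depend on the degree `c`. [arithmetic over the cell's definitions] -/
theorem polyTower_uniform {C : ℕ} (h : ∀ m K : ℕ, TropRootLawAt m K (2 ^ (C * (K + Nat.log 2 m ^ 2))))
    (c K m : ℕ) (hK : 4 ^ (max c 8) ≤ K) (hm : m ≤ K ^ c) : TropRootLawAt m K (2 ^ (2 * C * K)) := by
  refine tropRootLawAt_mono (Nat.pow_le_pow_right (by norm_num) ?_) (h m K)
  have h1 : Nat.log 2 m ^ 2 ≤ K := by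
    calc Nat.log 2 m ^ 2 ≤ (c * (Nat.log 2 K + 1)) ^ 2 := Nat.pow_le_pow_left (log_le_of_le_pow hm) 2
      _ = c ^ 2 * (Nat.log 2 K + 1) ^ 2 := by ring
      _ ≤ K := sq_log_succ_le_self c K hK
  nlinarith

/-- the `∃`-form: `TropKPlusLogSqLaw → ∃ C, ∀ c K m, 4^(max c 8) ≤ K → m ≤ K^c → TropRootLawAt m K (2^(C·K))`. -/
theorem polyTower_uniform_exists (h : TropKPlusLogSqLaw) :
    ∃ C : ℕ, ∀ c K m : ℕ, 4 ^ (max c 8) ≤ K → m ≤ K ^ c → TropRootLawAt m K (2 ^ (C * K)) := by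
  obtain ⟨C, hC⟩ := h
  exact ⟨2 * C, fun c K m hK hm => polyTower_uniform hC c K m hK hm⟩

/-- **The polynomial tower of degree `c`, all `K`.**  Under the law with constant `C`, every format `m ≤ K^c` (any `K`) has
`TropRootLawAt m K (2^(C·(D+2)·K))` with `D = 4c²(2·max c 8 + 1)²` (below the crossover `log₂² m ≤ D`; `K = 0` is `tropRootLawAt_zero`).
The registered foothold `stub_tropTowerLog` (`m = K⌊log₂ K⌋ ≤ K²`) and the square tower are the case `c = 2`. [arithmetic] -/
theorem polyTower {C : ℕ} (h : ∀ m K : ℕ, TropRootLawAt m K (2 ^ (C * (K + Nat.log 2 m ^ 2)))) (c K m : ℕ)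
    (hm : m ≤ K ^ c) : TropRootLawAt m K (2 ^ (C * (4 * c ^ 2 * (2 * max c 8 + 1) ^ 2 + 2) * K)) := by
  rcases Nat.eq_zero_or_pos K with rfl | hKpos
  · exact tropRootLawAt_zero m _
  set M := max c 8 with hM
  set D := 4 * c ^ 2 * (2 * M + 1) ^ 2 with hD
  refine tropRootLawAt_mono (Nat.pow_le_pow_right (by norm_num) ?_) (h m K)
  -- either past the crossover (`log₂² m ≤ K`) or below it (`log₂² m ≤ D`)
  have hsq : Nat.log 2 m ^ 2 ≤ K + D := by
    rcases Nat.lt_or_ge K (4 ^ M) with hK | hK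
    · -- `K < 4^M = 2^(2M)` ⇒ `⌊log₂ K⌋ < 2M`
      have hlogK : Nat.log 2 K < 2 * M := by
        have h4 : 4 ^ M = 2 ^ (2 * M) := by rw [pow_mul]; norm_num
        exact Nat.log_lt_of_lt_pow hKpos.ne' (h4 ▸ hK)
      have : Nat.log 2 m ^ 2 ≤ D := by
        calc Nat.log 2 m ^ 2 ≤ (c * (Nat.log 2 K + 1)) ^ 2 := Nat.pow_le_pow_left (log_le_of_le_pow hm) 2
          _ ≤ (c * (2 * M + 1)) ^ 2 := Nat.pow_le_pow_left (Nat.mul_le_mul_left c (by omega)) 2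
          _ ≤ D := by rw [hD]; nlinarith
      omega
    · have : Nat.log 2 m ^ 2 ≤ K := by
        calc Nat.log 2 m ^ 2 ≤ (c * (Nat.log 2 K + 1)) ^ 2 := Nat.pow_le_pow_left (log_le_of_le_pow hm) 2
          _ = c ^ 2 * (Nat.log 2 K + 1) ^ 2 := by ring
          _ ≤ K := sq_log_succ_le_self c K hK
      omega
  have hK1 : 1 ≤ K := hKpos
  calc C * (K + Nat.log 2 m ^ 2) ≤ C * (K + (K + D)) := Nat.mul_le_mul_left C (by omega)
    _ ≤ C * ((D + 2) * K) := Nat.mul_le_mul_left C (by nlinarith)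
    _ = C * (4 * c ^ 2 * (2 * M + 1) ^ 2 + 2) * K := by rw [hD]; ring

/-- the `∃`-form at a fixed degree: `TropKPlusLogSqLaw → ∀ c, ∃ C, ∀ K m, m ≤ K^c → TropRootLawAt m K (2^(C·K))`. -/
theorem polyTower_exists (h : TropKPlusLogSqLaw) (c : ℕ) :
    ∃ C : ℕ, ∀ K m : ℕ, m ≤ K ^ c → TropRootLawAt m K (2 ^ (C * K)) := by
  obtain ⟨C, hC⟩ := h
  exact ⟨C * (4 * c ^ 2 * (2 * max c 8 + 1) ^ 2 + 2), fun K m hm => polyTower hC c K m hm⟩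

/-! ## 3. The radix reading: a cap under the law, and the odometer target against it -/

/-- **RADIX CAP.**  Under `TropKPlusLogSqLaw` there is ONE radix `R` such that on every polynomial tower past its crossover
(`m ≤ K^c`, `4^(max c 8) ≤ K`) every sign-alternating dominant chain has at most `R^K` breakpoints: a `K`-digit odometer realised by
dominant terms on polynomially many nodes has radix `≤ R`. [arithmetic] -/
theorem radixCap_of_tropKPlusLogSqLaw (h : TropKPlusLogSqLaw) :
    ∃ R : ℕ, ∀ c K m : ℕ, 4 ^ (max c 8) ≤ K → m ≤ K ^ c → TropRootLawAt m K (R ^ K) := by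
  obtain ⟨C, hC⟩ := polyTower_uniform_exists h
  refine ⟨2 ^ C, fun c K m hK hm => ?_⟩
  rw [← pow_mul]
  exact hC c K m hK hm

/-- **THE CONSTRUCTION TARGET, POLYNOMIAL-NODE FORM.**  If for EVERY radix `r` there are `c, K₀` such that every `K ≥ K₀` admits a
design of some format `(m, K)` with `m ≤ K^c` nodes and a sign-alternating dominant chain of MORE than `r^K` terms
(`¬ TropRootLawAt m K (r^K)`), then the tropical `K + log² m` law fails.  Hypothesis NOT claimed (no such family is known for any
`r ≥ 2`); it is what a refutation of the crux on polynomial towers has to build. [arithmetic] -/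
theorem not_tropKPlusLogSqLaw_of_polyOdometers
    (hodo : ∀ r : ℕ, ∃ c K₀ : ℕ, ∀ K : ℕ, K₀ ≤ K → ∃ m : ℕ, m ≤ K ^ c ∧ ¬ TropRootLawAt m K (r ^ K)) :
    ¬ TropKPlusLogSqLaw := by
  intro h
  obtain ⟨R, hR⟩ := radixCap_of_tropKPlusLogSqLaw h
  obtain ⟨c, K₀, hK₀⟩ := hodo R
  -- a `K` past both thresholds
  set K := max K₀ (4 ^ (max c 8)) with hK
  obtain ⟨m, hm, hnot⟩ := hK₀ K (le_max_left _ _)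
  exact hnot (hR c K m (le_max_right _ _) hm)

/-- quantitative form of the cap, for a single radix: under the law with constant `C`, a radix `r ≥ 4^C` is out of reach on every
polynomial tower past its crossover — `TropRootLawAt m K (r^K)` for `m ≤ K^c`, `4^(max c 8) ≤ K`.  (So a located family of radix-`r`
odometers on `m ≤ K^c` nodes for all large `K` refutes the law with every constant `C ≤ ⌊log₄ r⌋`, and the `∀ r` hypothesis of
`not_tropKPlusLogSqLaw_of_polyOdometers` is exactly what beats every `C`.) [arithmetic] -/
theorem no_polyOdometer_of_law {C : ℕ} (h : ∀ m K : ℕ, TropRootLawAt m K (2 ^ (C * (K + Nat.log 2 m ^ 2))))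
    {r c K m : ℕ} (hr : 2 ^ (2 * C) ≤ r) (hK : 4 ^ (max c 8) ≤ K) (hm : m ≤ K ^ c) : TropRootLawAt m K (r ^ K) := by
  refine tropRootLawAt_mono ?_ (polyTower_uniform h c K m hK hm)
  rw [pow_mul]
  exact Nat.pow_le_pow_left hr K

end PolyTowers

end Summit.ValiantsHypothesis.ValiantsHypothesis.Theorems.KPlusLogSqLaw
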